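import Mathlib
import Literature.MathematicalPhysics.QuantumFieldTheory.ConstructiveQFTWave0Proofs
import HarnessLib

/-!
# THEOREM P′, abstract half — finite Gram partial sums of a reflection-positive pairing are lower bounds

HONEST FRAMING: exact (Metropolis-corrected) sampling algorithms for lattice gauge theory; figures of
merit are autocorrelation/cost numbers at stated couplings and volumes; no continuum-physics claim.

Support file of `SliceCovGramBound` (THEOREM P′) and `WitnessNearestNeighbour` (THEOREM P: the SIGN
`c₁ = K(1) > 0` of the nearest-neighbour slice covariance of the plaquette, (O3) of THEORY-1).
The tree's PROOF of Osterwalder–Seiler reflection positivity (`Literature…LatticeRPMechanism`,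
`…ConstructiveQFTWave0Proofs`) expands `Re ∫ u v exp(Σᵢ aᵢ bᵢ)` as the series
`Σ_{n ≥ 0} (1/n!) Σ_{w ∈ Iⁿ} Re ∫ (u ∏ₜ a_{wₜ})(v ∏ₜ b_{wₜ})` of non-negative word terms and keeps
only the conclusion `≥ 0`. This file keeps what the sign discards — a series of non-negative terms
dominates each of its finite partial sums:
* §1 `sum_words_le_re_integral_mul_mul_exp` [any finite measure]: under the hypotheses of the
  tree's `LatticeRP.integral_mul_mul_exp_sum_nonneg` (bounded measurable `u, v, aᵢ, bᵢ`, every word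
  term `≥ 0`), for every finite set `s` of word lengths
  `Σ_{n ∈ s} (1/n!) Σ_{w ∈ Iⁿ} Re ∫ (u ∏ a_w)(v ∏ b_w) ≤ Re ∫ u v exp(Σᵢ aᵢ bᵢ)`
  (dominated convergence exactly as in the tree, then `sum_le_hasSum`).
* §2 `sum_words_normSq_le_re_integral` [abstract lattice RP]: in the setting of the tree's
  `LatticeRP.integral_mul_conj_mul_exp_nonneg` (`Θ` preserves `μ = μ₀^ι`; `g, aᵢ` bounded measurable,
  supported on `P ∪ C`), `Σ_{n ∈ s} (1/n!) Σ_w |∫ g ∏_w a dμ|² ≤ Re ∫∫ g(z) conj g(ΘU)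
  exp(Σᵢ aᵢ(z) conj aᵢ(ΘU))`, because each word term IS `|∫ g ∏_w a dμ|²` (the tree's
  `LatticeRP.integral_splice_mul_conj_comp`).

NOT CLAIMED: anything model-specific (the Wilson theory enters in `SliceCovGramBound`); infinite
index sets; rates. References: K. Osterwalder, E. Seiler, Ann. Phys. 110 (1978) 440, §2; E. Seiler,
LNP 159 (1982) Thm. 2.2.
-/

noncomputable section

namespace Summit.Ventures.LatticeQCDFlow.TrivializingMaps

open MeasureTheory Finset
open scoped ComplexOrder ComplexConjugate

namespace WitnessColumn

open Literature.MathematicalPhysics.QuantumFieldTheory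

/-! ## §1. Finite partial sums of the Gram expansion are lower bounds (abstract) -/

section Gram

variable {Ω : Type*} [MeasurableSpace Ω] (ν : Measure Ω) [IsFiniteMeasure ν] {I : Type*} [Fintype I]

omit [IsFiniteMeasure ν] [Fintype I] in
/-- A bounded measurable complex function on a finite measure space is integrable. -/
private theorem integrable_of_norm_le [IsFiniteMeasure ν] {f : Ω → ℂ} (hf : Measurable f) {K : ℝ}
    (hK : ∀ x, ‖f x‖ ≤ K) : Integrable f ν :=
  Integrable.of_bound hf.aestronglyMeasurable K (ae_of_all _ hK)

omit [MeasurableSpace Ω] in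
/-- Norm of a product of `n` functions each bounded by `Ka`. -/
private theorem norm_prod_le_pow {n : ℕ} {c : Fin n → Ω → ℂ} {Ka : ℝ} (hc : ∀ t x, ‖c t x‖ ≤ Ka)
    (x : Ω) : ‖∏ t, c t x‖ ≤ |Ka| ^ n := by
  calc ‖∏ t, c t x‖ = ∏ t, ‖c t x‖ := norm_prod _ _
    _ ≤ ∏ _t : Fin n, |Ka| :=
        Finset.prod_le_prod (fun _ _ => norm_nonneg _) fun t _ => (hc t x).trans (le_abs_self _)
    _ = |Ka| ^ n := by simp

/-- **Finite partial sums of the Gram expansion are lower bounds.** Let `u, v, aᵢ, bᵢ` be bounded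
measurable complex functions on a finite measure space with `∫ (u ∏ₜ a_{wₜ})(v ∏ₜ b_{wₜ}) dν ≥ 0` for
every finite word `w` (the hypotheses of the tree's `LatticeRP.integral_mul_mul_exp_sum_nonneg`). Then
for every finite set `s` of lengths,
`Σ_{n ∈ s} (n!)⁻¹ Σ_{w : Fin n → I} Re ∫ (u ∏ a_w)(v ∏ b_w) dν ≤ Re ∫ u v exp(Σᵢ aᵢ bᵢ) dν`.
(Expand the exponential, dominated convergence, `(Σᵢ aᵢbᵢ)ⁿ = Σ_w ∏a_w ∏b_w`, and a series of
non-negative reals dominates its partial sums.) -/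
theorem sum_words_le_re_integral_mul_mul_exp (u v : Ω → ℂ) (a b : I → Ω → ℂ)
    (hu : Measurable u) (hv : Measurable v) (ha : ∀ i, Measurable (a i))
    (hb : ∀ i, Measurable (b i)) {Ku Ka : ℝ} (hub : ∀ x, ‖u x‖ ≤ Ku) (hvb : ∀ x, ‖v x‖ ≤ Ku)
    (hab : ∀ i x, ‖a i x‖ ≤ Ka) (hbb : ∀ i x, ‖b i x‖ ≤ Ka)
    (hpos : ∀ (n : ℕ) (w : Fin n → I),
      0 ≤ ∫ x, (u x * ∏ t, a (w t) x) * (v x * ∏ t, b (w t) x) ∂ν) (s : Finset ℕ) :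
    ∑ n ∈ s, ((n.factorial : ℝ)⁻¹ *
        ∑ w : Fin n → I, (∫ x, (u x * ∏ t, a (w t) x) * (v x * ∏ t, b (w t) x) ∂ν).re)
      ≤ (∫ x, u x * v x * Complex.exp (∑ i, a i x * b i x) ∂ν).re := by
  classical
  set S : Ω → ℂ := fun x => ∑ i, a i x * b i x with hS_def
  have hSm : Measurable S := Finset.measurable_sum _ fun i _ => (ha i).mul (hb i)
  set B : ℝ := (Fintype.card I : ℝ) * (Ka * Ka) with hB_def
  have hSB : ∀ x, ‖S x‖ ≤ B := fun x => by
    calc ‖S x‖ ≤ ∑ i, ‖a i x * b i x‖ := norm_sum_le _ _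
      _ ≤ ∑ _i : I, Ka * Ka := Finset.sum_le_sum fun i _ => by
          rw [norm_mul]
          exact mul_le_mul (hab i x) (hbb i x) (norm_nonneg _) ((norm_nonneg _).trans (hab i x))
      _ = B := by rw [Finset.sum_const, Finset.card_univ, nsmul_eq_mul]
  -- the terms of the exponential series and their sum (dominated convergence)
  set T : ℕ → Ω → ℂ := fun n x => u x * v x * (S x ^ n / (n.factorial : ℂ)) with hT_def
  have hTm : ∀ n, Measurable (T n) := fun n =>
    (hu.mul hv).mul ((hSm.pow_const n).div_const _)
  have hlim : ∀ x, HasSum (fun n => T n x) (u x * v x * Complex.exp (S x)) := fun x => by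
    have h := NormedSpace.expSeries_div_hasSum_exp (S x)
    rw [← congr_fun Complex.exp_eq_exp_ℂ (S x)] at h
    exact h.mul_left (u x * v x)
  set bound : ℕ → Ω → ℝ := fun n _ => Ku * Ku * (B ^ n / (n.factorial : ℝ)) with hbound_def
  have hTb : ∀ n x, ‖T n x‖ ≤ bound n x := fun n x => by
    simp only [hT_def, hbound_def, norm_mul, norm_div, norm_pow, Complex.norm_natCast]
    have h1 : ‖u x‖ * ‖v x‖ ≤ Ku * Ku :=
      mul_le_mul (hub x) (hvb x) (norm_nonneg _) ((norm_nonneg _).trans (hub x))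
    have h2 : ‖S x‖ ^ n / (n.factorial : ℝ) ≤ B ^ n / (n.factorial : ℝ) :=
      div_le_div_of_nonneg_right (pow_le_pow_left₀ (norm_nonneg _) (hSB x) n) (Nat.cast_nonneg _)
    exact mul_le_mul h1 h2 (by positivity) (mul_self_nonneg _)
  have hsum : HasSum (fun n => ∫ x, T n x ∂ν) (∫ x, u x * v x * Complex.exp (S x) ∂ν) := by
    refine hasSum_integral_of_dominated_convergence bound
      (fun n => (hTm n).aestronglyMeasurable) (fun n => ae_of_all _ (hTb n))
      (ae_of_all _ fun x => ?_) ?_ (ae_of_all _ hlim)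
    · exact (Real.summable_pow_div_factorial B).mul_left (Ku * Ku)
    · show Integrable (fun _ => ∑' n : ℕ, Ku * Ku * (B ^ n / ((n.factorial : ℕ) : ℝ))) ν
      exact integrable_const _
  -- each term, integrated, is `(n!)⁻¹ Σ_w ∫ (u∏a_w)(v∏b_w)`
  have hint : ∀ (n : ℕ) (w : Fin n → I),
      Integrable (fun x => (u x * ∏ t, a (w t) x) * (v x * ∏ t, b (w t) x)) ν := fun n w => by
    refine integrable_of_norm_le ν
      ((hu.mul (Finset.measurable_prod _ fun t _ => ha (w t))).mul
        (hv.mul (Finset.measurable_prod _ fun t _ => hb (w t))))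
      (K := (|Ku| * |Ka| ^ n) * (|Ku| * |Ka| ^ n)) fun x => ?_
    rw [norm_mul, norm_mul, norm_mul]
    have hua : ‖u x‖ * ‖∏ t, a (w t) x‖ ≤ |Ku| * |Ka| ^ n :=
      mul_le_mul ((hub x).trans (le_abs_self _)) (norm_prod_le_pow (fun t => hab (w t)) x)
        (norm_nonneg _) (abs_nonneg _)
    have hvb' : ‖v x‖ * ‖∏ t, b (w t) x‖ ≤ |Ku| * |Ka| ^ n :=
      mul_le_mul ((hvb x).trans (le_abs_self _)) (norm_prod_le_pow (fun t => hbb (w t)) x)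
        (norm_nonneg _) (abs_nonneg _)
    exact mul_le_mul hua hvb' (by positivity) (by positivity)
  have hTint : ∀ n, ∫ x, T n x ∂ν = (((n.factorial : ℝ)⁻¹ : ℝ) : ℂ) *
      ∑ w : Fin n → I, ∫ x, (u x * ∏ t, a (w t) x) * (v x * ∏ t, b (w t) x) ∂ν := fun n => by
    have hTn : ∀ x, T n x = (((n.factorial : ℝ)⁻¹ : ℝ) : ℂ) *
        ∑ w : Fin n → I, (u x * ∏ t, a (w t) x) * (v x * ∏ t, b (w t) x) := fun x => by
      have hpow : S x ^ n = ∑ w : Fin n → I, (∏ t, a (w t) x) * ∏ t, b (w t) x := by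
        simp only [hS_def, Fintype.sum_pow, Finset.prod_mul_distrib]
      simp only [hT_def, hpow, div_eq_mul_inv, Finset.mul_sum, Finset.sum_mul, Complex.ofReal_inv,
        Complex.ofReal_natCast]
      exact Finset.sum_congr rfl fun w _ => by ring
    simp_rw [hTn]
    rw [integral_const_mul, integral_finsetSum _ fun w _ => hint n w]
  have hterm : ∀ n, (∫ x, T n x ∂ν).re = (n.factorial : ℝ)⁻¹ *
      ∑ w : Fin n → I, (∫ x, (u x * ∏ t, a (w t) x) * (v x * ∏ t, b (w t) x) ∂ν).re := fun n => by
    rw [hTint n, Complex.re_ofReal_mul, Complex.re_sum]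
  have hnn : ∀ n, 0 ≤ (∫ x, T n x ∂ν).re := fun n => by
    rw [hterm n]
    exact mul_nonneg (inv_nonneg.2 (Nat.cast_nonneg _))
      (Finset.sum_nonneg fun w _ => (Complex.nonneg_iff.1 (hpos n w)).1)
  calc ∑ n ∈ s, ((n.factorial : ℝ)⁻¹ *
        ∑ w : Fin n → I, (∫ x, (u x * ∏ t, a (w t) x) * (v x * ∏ t, b (w t) x) ∂ν).re)
      = ∑ n ∈ s, (∫ x, T n x ∂ν).re := Finset.sum_congr rfl fun n _ => (hterm n).symm
    _ ≤ (∫ x, u x * v x * Complex.exp (S x) ∂ν).re :=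
        sum_le_hasSum s (fun n _ => hnn n) (Complex.hasSum_re hsum)

end Gram

/-! ## §2. Abstract lattice reflection positivity: the word moments are dominated -/

section Abstract

variable {ι : Type*} [Fintype ι] [DecidableEq ι] {G : Type*} [MeasurableSpace G]
  (μ₀ : Measure G) [IsProbabilityMeasure μ₀] (P C : Finset ι) (Θ : (ι → G) → (ι → G))

/-- **Word moments are dominated by the reflection-positive form.** In the setting of the tree's
`LatticeRP.integral_mul_conj_mul_exp_nonneg` (`Θ` preserves `μ = μ₀^ι`, the `P ∪ C`-coordinates of
`ΘU` depend only on `U` off `P`; `g, aᵢ` bounded measurable depending only on `P ∪ C`), for every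
finite set `s` of word lengths
`Σ_{n ∈ s} (n!)⁻¹ Σ_{w : Fin n → I} |∫ g ∏ₜ a_{wₜ} dμ|² ≤ Re ∫∫ g(z) conj g(ΘU) exp(Σᵢ aᵢ(z) conj aᵢ(ΘU))`,
`z = splice_C(U, Y)`: each word term of the Gram expansion is `|∫ g ∏ a_w dμ|²`
(`LatticeRP.integral_splice_mul_conj_comp`). -/
theorem sum_words_normSq_le_re_integral
    (hΘ : MeasurePreserving Θ (LatticeRP.piMeasure μ₀) (LatticeRP.piMeasure μ₀))
    (hΘdep : ∀ e ∈ P ∪ C, DependsOn (fun U => Θ U e) ((Pᶜ : Finset ι) : Set ι))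
    {I : Type*} [Fintype I] {g : (ι → G) → ℂ} {a : I → (ι → G) → ℂ}
    (hgm : Measurable g) (ham : ∀ i, Measurable (a i)) {Kg Ka : ℝ} (hgb : ∀ U, ‖g U‖ ≤ Kg)
    (hab : ∀ i U, ‖a i U‖ ≤ Ka) (hgdep : DependsOn g ((P ∪ C : Finset ι) : Set ι))
    (hadep : ∀ i, DependsOn (a i) ((P ∪ C : Finset ι) : Set ι)) (s : Finset ℕ) :
    ∑ n ∈ s, ((n.factorial : ℝ)⁻¹ *
        ∑ w : Fin n → I, ‖∫ U, g U * ∏ t, a (w t) U ∂(LatticeRP.piMeasure μ₀)‖ ^ 2)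
      ≤ (∫ p, g (LatticeRP.splice C p) * conj (g (Θ p.1)) *
          Complex.exp (∑ i, a i (LatticeRP.splice C p) * conj (a i (Θ p.1)))
        ∂((LatticeRP.piMeasure μ₀).prod (LatticeRP.piMeasure μ₀))).re := by
  have hΘm : Measurable Θ := hΘ.measurable
  have hconj : Measurable (starRingEnd ℂ : ℂ → ℂ) := Complex.continuous_conj.measurable
  -- the word `w` gives the observable `Φ_w = g ∏ₜ a_{wₜ}`, and its term is `|∫ Φ_w|²`
  have hword : ∀ (n : ℕ) (w : Fin n → I),
      ∫ p, (g (LatticeRP.splice C p) * ∏ t, a (w t) (LatticeRP.splice C p)) *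
          (conj (g (Θ p.1)) * ∏ t, conj (a (w t) (Θ p.1)))
        ∂((LatticeRP.piMeasure μ₀).prod (LatticeRP.piMeasure μ₀))
      = (∫ U, g U * ∏ t, a (w t) U ∂(LatticeRP.piMeasure μ₀)) *
          conj (∫ U, g U * ∏ t, a (w t) U ∂(LatticeRP.piMeasure μ₀)) := by
    intro n w
    set Φ : (ι → G) → ℂ := fun U => g U * ∏ t, a (w t) U with hΦ_def
    have hΦm : Measurable Φ := hgm.mul (Finset.measurable_prod _ fun t _ => ham (w t))
    have hΦb : ∀ U, ‖Φ U‖ ≤ |Kg| * |Ka| ^ n := fun U => by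
      rw [hΦ_def, norm_mul]
      refine mul_le_mul ((hgb U).trans (le_abs_self _)) ?_ (norm_nonneg _) (abs_nonneg _)
      calc ‖∏ t, a (w t) U‖ = ∏ t, ‖a (w t) U‖ := norm_prod _ _
        _ ≤ ∏ _t : Fin n, |Ka| :=
            Finset.prod_le_prod (fun _ _ => norm_nonneg _) fun t _ =>
              (hab _ _).trans (le_abs_self _)
        _ = |Ka| ^ n := by simp
    have hΦdep : DependsOn Φ ((P ∪ C : Finset ι) : Set ι) := fun U V hUV => by
      simp only [hΦ_def]
      rw [hgdep hUV]
      congr 1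
      exact Finset.prod_congr rfl fun t _ => hadep (w t) hUV
    have key := LatticeRP.integral_splice_mul_conj_comp μ₀ P C Θ hΘ hΘdep hΦm hΦb hΦdep
    rw [← key]
    refine integral_congr_ae (ae_of_all _ fun p => ?_)
    simp only [hΦ_def, map_mul, map_prod]
  have main := sum_words_le_re_integral_mul_mul_exp
    ((LatticeRP.piMeasure μ₀).prod (LatticeRP.piMeasure μ₀)) (fun p => g (LatticeRP.splice C p))
    (fun p => conj (g (Θ p.1))) (fun i p => a i (LatticeRP.splice C p))
    (fun i p => conj (a i (Θ p.1)))
    (hgm.comp (LatticeRP.measurable_splice C)) (hconj.comp (hgm.comp (hΘm.comp measurable_fst)))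
    (fun i => (ham i).comp (LatticeRP.measurable_splice C))
    (fun i => hconj.comp ((ham i).comp (hΘm.comp measurable_fst)))
    (Ku := Kg) (Ka := Ka) (fun p => hgb _) (fun p => by rw [Complex.norm_conj]; exact hgb _)
    (fun i p => hab i _) (fun i p => by rw [Complex.norm_conj]; exact hab i _)
    (fun n w => by
      rw [hword n w, Complex.mul_conj', ← Complex.ofReal_pow]
      exact Complex.zero_le_real.2 (sq_nonneg _)) s
  refine le_trans (le_of_eq (Finset.sum_congr rfl fun n _ => ?_)) main
  congr 1
  refine Finset.sum_congr rfl fun w _ => ?_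
  rw [hword n w, Complex.mul_conj', ← Complex.ofReal_pow, Complex.ofReal_re]

end Abstract

end WitnessColumn

end Summit.Ventures.LatticeQCDFlow.TrivializingMaps

end
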